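import Summits.CriticalPhenomena.CardyFormulaZ2.Theorems.CardyDualCurrentCanonicalLimitFromExactCRRealForm

/-!
# The per-range census questions in real form
(crux stmt-CriticalPhenomena-11394 `CardyDualCurrent.CanonicalLimitFromExactCR`, line `registered`; companion of
`CardyDualCurrentCanonicalLimitFromExactCRRealForm.lean`)

`rePart` / `imPart` (real and imaginary parts of a finite-range local parafermionic template,
built from the conjugate-staggering `T†`) preserve the range and the spin class `(1/3)ℤ`; hence,
exactly as for the decision crux `DualCurrentTemplateR` (`dualCurrentTemplateR_iff_exists_realForm`),
the per-range negative items of route `CardyDualCurrent` — `NoDualCurrentRangeOne`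
(stmt-CriticalPhenomena-11202) and `NoDualCurrentRangeZero` (stmt-CriticalPhenomena-11204) — are
equivalent to their restrictions to templates OF REAL FORM (horizontal observable real, vertical
observable purely imaginary in every admissible domain): the census unknowns are one real pair
`(Re G(·,0), Im G(·,1))`, i.e. real (`not_exists_thirdSpins_iff_realForm`,
`noDualCurrentRangeOne_iff_realForm`, `noDualCurrentRangeZero_iff_realForm`).
-/

noncomputable section

namespace Summit.CriticalPhenomena.CardyFormulaZ2.Cruxes.CanonicalLimitFromExactCR.Birth

open Literature.Probability Literature.Probability.LatticeModels

namespace RealForm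

/-! ### The census items halve too: range and spin class are preserved by `rePart` / `imPart` -/

/-- The real part has the same range. [folklore] -/
theorem rePart_r (T : LocalParafermionicTemplate) : (rePart T).r = T.r := rfl

/-- The imaginary part has the same range. [folklore] -/
theorem imPart_r (T : LocalParafermionicTemplate) : (imPart T).r = T.r := rfl

/-- Spins in `(1/3)ℤ` are preserved by `rePart` (the appended spins are the negatives).
[folklore] -/
theorem hasThirdSpins_rePart {T : LocalParafermionicTemplate} (h : T.HasThirdSpins) :
    (rePart T).HasThirdSpins := by
  intro i k
  induction k using Fin.addCases with
  | left k =>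
    obtain ⟨n, hn⟩ := h i k
    refine ⟨n, ?_⟩
    show Fin.append (T.s i) (fun k => -(T.s i k)) (Fin.castAdd T.m k) = _
    rw [Fin.append_left, hn]
  | right k =>
    obtain ⟨n, hn⟩ := h i k
    refine ⟨-n, ?_⟩
    show Fin.append (T.s i) (fun k => -(T.s i k)) (Fin.natAdd T.m k) = _
    rw [Fin.append_right, hn]
    push_cast
    ring

/-- Spins in `(1/3)ℤ` are preserved by `imPart`. [folklore] -/
theorem hasThirdSpins_imPart {T : LocalParafermionicTemplate} (h : T.HasThirdSpins) :
    (imPart T).HasThirdSpins := by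
  intro i k
  induction k using Fin.addCases with
  | left k =>
    obtain ⟨n, hn⟩ := h i k
    refine ⟨n, ?_⟩
    show Fin.append (T.s i) (fun k => -(T.s i k)) (Fin.castAdd T.m k) = _
    rw [Fin.append_left, hn]
  | right k =>
    obtain ⟨n, hn⟩ := h i k
    refine ⟨-n, ?_⟩
    show Fin.append (T.s i) (fun k => -(T.s i k)) (Fin.natAdd T.m k) = _
    rw [Fin.append_right, hn]
    push_cast
    ring

/-- **The per-range census questions in real form** (registered sub-goal
`not_exists_thirdSpins_iff_realForm` of line `registered`): at every fixed medial range `r₀`,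
"no template of range `r₀` with spins in `(1/3)ℤ` is exactly CR and non-degenerate" is equivalent
to the same statement restricted to templates OF REAL FORM (horizontal observable real, vertical
observable purely imaginary in every admissible domain) — `rePart` / `imPart` preserve range, spin
class and exact CR, and one of them inherits non-degeneracy.  The unknowns of the census items
`NoDualCurrentRangeOne` (stmt-CriticalPhenomena-11202) and `NoDualCurrentRangeZero`
(stmt-CriticalPhenomena-11204) are therefore real (one real pair `(Re G(·,0), Im G(·,1))`).
[folklore] -/
theorem not_exists_thirdSpins_iff_realForm : ∀ r₀ : ℕ, (¬ ∃ T : Literature.Probability.LatticeModels.LocalParafermionicTemplate, T.r = r₀ ∧ T.HasThirdSpins ∧ T.IsExactCR ∧ T.Nondegenerate) ↔ ¬ ∃ T : Literature.Probability.LatticeModels.LocalParafermionicTemplate, T.r = r₀ ∧ T.HasThirdSpins ∧ T.IsExactCR ∧ T.Nondegenerate ∧ ∀ D : Literature.Probability.LatticeModels.DiscreteDobrushin, D.IsZdAdmissible → ∀ x : Literature.Probability.LatticeModels.Site 2, (T.obs D x 0).im = 0 ∧ (T.obs D x 1).re = 0 := by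
  intro r₀
  refine not_congr ⟨?_, ?_⟩
  · rintro ⟨T, hr, hs, hCR, hND⟩
    rcases nondegenerate_rePart_or_imPart hND with h | h
    · exact ⟨rePart T, hr, hasThirdSpins_rePart hs, isExactCR_rePart hCR, h, rePart_realForm T⟩
    · exact ⟨imPart T, hr, hasThirdSpins_imPart hs, isExactCR_imPart hCR, h, imPart_realForm T⟩
  · rintro ⟨T, hr, hs, hCR, hND, -⟩
    exact ⟨T, hr, hs, hCR, hND⟩

/-- **`NoDualCurrentRangeOne` in real form**: the route's range-1 negative crux
(stmt-CriticalPhenomena-11202) is equivalent to the non-existence of a range-1, third-spin,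
exactly-CR, non-degenerate template of real form. [folklore] -/
theorem noDualCurrentRangeOne_iff_realForm :
    Summit.CriticalPhenomena.CardyFormulaZ2.Theses.CardyDualCurrent.NoDualCurrentRangeOne ↔
      ¬ ∃ T : LocalParafermionicTemplate, T.r = 1 ∧ T.HasThirdSpins ∧ T.IsExactCR ∧
        T.Nondegenerate ∧ ∀ D : DiscreteDobrushin, D.IsZdAdmissible → ∀ x : Site 2,
          (T.obs D x 0).im = 0 ∧ (T.obs D x 1).re = 0 :=
  (LocalParafermionicTemplate.not_exists_thirdSpins_iff 1).symm.trans
    (not_exists_thirdSpins_iff_realForm 1)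

/-- **`NoDualCurrentRangeZero` in real form**: the route's range-0 negative support item
(stmt-CriticalPhenomena-11204) is equivalent to the non-existence of a range-0, third-spin,
exactly-CR, non-degenerate template of real form. [folklore] -/
theorem noDualCurrentRangeZero_iff_realForm :
    Summit.CriticalPhenomena.CardyFormulaZ2.Theses.CardyDualCurrent.NoDualCurrentRangeZero ↔
      ¬ ∃ T : LocalParafermionicTemplate, T.r = 0 ∧ T.HasThirdSpins ∧ T.IsExactCR ∧
        T.Nondegenerate ∧ ∀ D : DiscreteDobrushin, D.IsZdAdmissible → ∀ x : Site 2,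
          (T.obs D x 0).im = 0 ∧ (T.obs D x 1).re = 0 :=
  (LocalParafermionicTemplate.not_exists_thirdSpins_iff 0).symm.trans
    (not_exists_thirdSpins_iff_realForm 0)

end RealForm

end Summit.CriticalPhenomena.CardyFormulaZ2.Cruxes.CanonicalLimitFromExactCR.Birth

end
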